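import Summits.ABC.IUTFork.Cor312VolumesRealFrames
import Summits.ABC.IUTFork.Cor312VolumesSummands
import Summits.ABC.IUTFork.Cor312StepXReal
import Summits.ABC.IUTFork.Thm311Real3
import Literature.IUT.LogVolume.HaarTransport
import HarnessLib

/-!
# [IUTchIII] Cor. 3.12, TEAM B row B-4 (volume half): Thm 3.11 (ii) (a) `KummerA` / `LogvolPrecise` for the
# REAL weighted containers — factorwise (all places, radial archimedean factors included) and summandwise

Record-only file (D-0012) of the abc-iut cell (Cor. 3.12 strategy TEAM B «estimate / log-Kummer», HUMAN RULING
D-0067 (3), row B-4 of `HOME/plan/C312-TEAMS.md`, «volume half», seat abc-iut-c312-6 gen 3); PROOF-ONLY; TAKES NO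
SIDE. [IUTchIII] Thm. 3.11 (ii) (a) (kurims `paper:url-4b091feeb646` p. 155: the Kummer isomorphisms of local
mono-analytic tensor packets are "all … compatible with the respective log-volumes [cf. Proposition 3.9, (ii)]") is
abc-iut-c312-1's `Thm311.Column.KummerA C D` (for every `m`, on `D`-admissible regions `C.frobAdm m` holds and
`C.frobLogvol m = D.logvol`); Step (x) of the proof of Cor. 3.12 consumes it (TEAM A `Cor312StepXReal.stepX_holds`,
binder `hKumA`; `StepX.LogvolLogLink`). abc-iut-c312-12's `Cor312KummerVolumeReal` (row B-4 core) discharges it for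
volumes read through ONE container with a normalised Haar measure and a lattice-carrying additive homeomorphism.
The REAL containers of the statement files are WEIGHTED SUMS over several factors, and at archimedean places the
factor volume is the RADIAL one ([AbsTopIII] Prop. 5.7 (ii)), not a Haar measure of the carrier; this file gives the
discharge for those containers, with the Kummer isomorphism realised as print describes its effect on the packets —
FACTORWISE on the direct sum of fields ([IUTchIII] Prop. 3.1 (i) p. 93: the packet "may be regarded as an inductive
limit of direct sums of ind-topological fields. Such decompositions as direct sums of ind-topological fields are
uniquely determined by the ind-topological ring structure"; Prop. 3.9 (ii) p. 116: the mono-analytic log-volumes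
"are compatible with the log-volumes obtained in (i), relative to the natural poly-isomorphisms of Proposition 3.2,
(i)", themselves induced place by place from `log(†𝒟⊢_v) ⥲ log(†ℱ⊢×μ_v) ⥲ log(†ℱ_v)`, Prop. 3.2 (i) p. 98):
* §1 FACTOR LEVEL (gen-2 `Cor312Vol.FactorVolume`): `ofUltrametric K` (Haar, `μ(𝒪_K) = 1`) is invariant under
  norm-preserving additive homeomorphisms and under additive homeomorphisms fixing SOME lattice (abc-iut-c312-d1
  `HaarTransport` — cited, not re-proved); `complexRadial` (RADIAL volume `length(pr_ℝ(A))`, `pr_ℝ = ‖·‖`) under ANY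
  norm-preserving self-map of `ℂ`; `precomp` transports invariance along the comparison.
* §2 `FrameVolumePieces.kummerA_of_factorwiseRealisations` (+ `logvolPrecise_…`): for `D` realising gen-2's
  all-places container `V` (box-admissibility over the field factors, `Σ_i w_i·log vol_i`) and a column whose `m`-th
  transported data are `V`'s readings PRE-COMPOSED with a FACTORWISE realisation `Π_i φ_{m,i}`, each `φ_{m,i}`
  preserving `vol_i`, **`KummerA C D` HOLDS** (boxes go to boxes with factors of the same volume).
* §3 `SummandPieces.kummerA_of_preservesRegions` (+ `logvolPrecise_…`): the same over abc-iut-c312-5's VERBATIM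
  container of Rmk. 3.1.1 (iii) p. 95 (direct product regions over the SUMMANDS `v⃗`, `Σ_{v⃗} w_{v⃗}·log μ_{v⃗}`) for
  realisations in their `PreservesRegions` (e.g. summandwise measure-preserving bijections, Dupuy–Hilado §4.9).
* §4 `FrameVolumePieces.logvolLogLink_ofFrames` / `hKumA_ofFrames`: at c312-7's per-place assembler
  `Setting.ofFrames` over a realised `V`, TEAM A's `StepX.LogvolLogLink` and the `hKumA` binder of `stepX_holds`
  HOLD for every factorwise-realised column (`hMono` = gen-2 `logvolMono_ofFrames`; the (Ind1)/(Ind2) binders need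
  the summandwise container, c312-5 `Cor312VolumesSummandsBridge`, per gen 2's CAVEAT).
* §5 VACUITY AUDIT EXTENDED (`partII_iff_ind3_of_factorwiseTwist` / `…_of_preservesRegionsTwist`): abc-iut-c312-5's
  neutral audit `partII_iff_ind3_of_coric` (STRICTIFIED reading: typed Thm. 3.11 (ii) ⟺ (Ind3) alone) survives
  every HONEST volume twist — for `Column.ofDivisors` with (a)-data read through ANY factorwise volume-preserving
  (resp. container-preserving) realisation and coric (b)(c)-data, `PartII D ↔ Ind3 D` still: at this level of typing
  (ii) (a) carries no content beyond (Ind3) for all isometric Kummer transports, not only for Kummer = identity.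
* §6 NON-VACUITY with NON-IDENTITY realisations (complex conjugation, unit rotations, `−1`, unit multiplications).
Packet-level instances of Prop. 3.9 (ii) in abc-iut-L6-t4's vocabulary are abc-iut-L6-d3's
`LogThetaLattice.PacketLogVolumesProofs2/3` (p411342/p411711) — cited, not restated; this file is the COLUMN-level
wiring for the containers the Cor. 3.12 statement files instantiate. Sources read on the page (kurims
`paper:url-4b091feeb646`): [IUTchIII] p. 93 (Prop. 3.1 (i)(ii)), pp. 94–96 (Rmk. 3.1.1 (ii)(iii)), pp. 97–99
(Prop. 3.2 (i)(ii)), pp. 115–117 (Prop. 3.9 (i)(ii)(iv)), pp. 155–156 (Thm. 3.11 (ii) (a), final clause), pp. 180–181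
(Step (x)); [AbsTopIII] Prop. 5.7 (i)(ii) pp. 137–138; Dupuy–Hilado §4.7, §4.9.
[claim: Mochizuki2012, status: disputed] [cite: DupuyHilado2025, §4.7] Everything proved is bookkeeping / measure
theory; NO new definition, NO new `Prop`. Deliberately NOT here: which `φ_{m,i}` the printed Kummer isomorphism
induces at the real carriers (instance data: abc-iut-c312-3 / abc-iut-c312-5), (ii) (b)(c), (Ind3), any judgement.
-/

noncomputable section

open Set MeasureTheory Metric
open scoped ENNReal Pointwise

namespace Summit.ABC

namespace IUTFork

namespace Cor312Vol

open Thm311 Cor312 Literature.IUT.LogVolume Literature.IUT.LogThetaLattice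

variable {T : ThetaIndex}

/-! ## 1. Factor volumes are invariant under the factor-level Kummer realisations -/

namespace FactorVolume

/-- Transport: if `f` intertwines a self-map `φ` of `K` with a `μ`-preserving self-map `φ'` of `K'`, then `φ`
preserves the transported factor volume `μ.precomp f`. [folklore] -/
theorem precomp_vol_image_eq {K : Type} [NormedField K] {K' : Type} [NormedField K'] (μ : FactorVolume K')
    (f : K → K') (hf : ∀ r : ℝ, f '' closedBall 0 r = closedBall 0 r) {φ : K → K} {φ' : K' → K'}
    (hcomm : ∀ x, f (φ x) = φ' (f x)) (hφ' : ∀ R : Set K', μ.vol (φ' '' R) = μ.vol R) (R : Set K) :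
    (μ.precomp f hf).vol (φ '' R) = (μ.precomp f hf).vol R := by
  show μ.vol (f '' (φ '' R)) = μ.vol (f '' R)
  rw [Set.image_image, show (fun x => f (φ x)) = fun x => φ' (f x) from funext hcomm, ← Set.image_image, hφ']

section Ultrametric

variable (K : Type) [NontriviallyNormedField K] [IsUltrametricDist K] [ProperSpace K] [MeasurableSpace K]
  [BorelSpace K]

/-- **Nonarchimedean factor** ([AbsTopIII] Prop. 5.7 (i)(b) p. 138 "if `x ∈ O_k^×`, then `μ^log_k(x·A) = μ^log_k(A)`";
Dupuy–Hilado §4.7): a NORM-PRESERVING additive homeomorphism of `K` — a continuous field automorphism that is an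
isometry, multiplication by a unit, `x ↦ −x` — preserves the Haar factor volume (abc-iut-c312-d1
`localVolume_image_of_norm_map_eq`). [cite: MochizukiAbsTopIII2015, Prop. 5.7 (i)(b) p. 138] -/
theorem ofUltrametric_vol_image_of_norm_map_eq (φ : K ≃ₜ+ K) (hφ : ∀ x, ‖φ x‖ = ‖x‖) (R : Set K) :
    (ofUltrametric K).vol (φ '' R) = (ofUltrametric K).vol R :=
  localVolume_image_of_norm_map_eq K φ hφ R

/-- **Nonarchimedean factor, lattice form** (Dupuy–Hilado §4.9 "`ℤ_p`-lattice isomorphisms"): an additive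
homeomorphism of `K` carrying SOME integral structure onto itself preserves the Haar factor volume (abc-iut-c312-d1
`localVolume_image_of_preserves`; the single-Haar criterion of abc-iut-c312-12 at one factor).
[cite: DupuyHilado2025, §4.9] -/
theorem ofUltrametric_vol_image_of_preserves (φ : K ≃ₜ+ K) (Λ₀ : IntegralStructure K)
    (hφ : φ '' (Λ₀ : Set K) = (Λ₀ : Set K)) (R : Set K) :
    (ofUltrametric K).vol (φ '' R) = (ofUltrametric K).vol R :=
  localVolume_image_of_preserves K φ Λ₀ hφ R

end Ultrametric

/-- **Archimedean factor** ([AbsTopIII] Prop. 5.7 (ii) p. 138: the radial volume is "the length of" the radial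
projection `pr_ℝ(A) ⊆ ℝ`, `pr_ℝ = ‖·‖`): ANY norm-preserving self-map of `ℂ` — complex conjugation, rotations,
`z ↦ −z`, every continuous field automorphism — preserves the RADIAL factor volume, since it does not move
`pr_ℝ(A)`. [cite: MochizukiAbsTopIII2015, Prop. 5.7 (ii)(a) p. 138] -/
theorem complexRadial_vol_image_of_norm_map_eq (φ : ℂ → ℂ) (hφ : ∀ z, ‖φ z‖ = ‖z‖) (R : Set ℂ) :
    complexRadial.vol (φ '' R) = complexRadial.vol R := by
  show radialVolume (φ '' R) = radialVolume R
  unfold radialVolume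
  rw [Set.image_image]
  exact congrArg _ (congrArg (· '' R) (funext fun z => hφ z))

end FactorVolume

/-! ## 2. `KummerA` over the all-places container from FACTORWISE volume-preserving realisations -/

namespace FrameVolumePieces

variable {L : LogShells T} (V : FrameVolumePieces L) (C : Column L) (D : MRData L)
  (φ : ℤ → ∀ (j : T.Label) (vQ : T.VQ) (i : V.J j vQ), V.K j vQ i → V.K j vQ i)

/-- **[IUTchIII] Thm. 3.11 (ii) (a) (kurims p. 155), real discharge over the all-places weighted container —
`KummerA` from FACTORWISE volume-preserving realisations.** Let the line data `D` realise `V` (gen 2 `Realizes`: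
`D.Adm = V.Adm` box-admissibility over the field factors, `D.logvol = V.logvol = Σ_i w_i·log vol_i`), and let the
column's `m`-th transported holomorphic admissibility / log-volume be `V`'s readings of the image pre-composed with
the factorwise map `Π_i φ_{m,i}` realising the `m`-th Kummer isomorphism on the factors (Prop. 3.1 (i) p. 93:
the decomposition of a packet "as direct sums of ind-topological fields [is] uniquely determined by the
ind-topological ring structure"), each `φ_{m,i}` preserving the factor volume `vol_i` (§1: isometric field
isomorphisms at every place). Then on `D`-admissible regions the transported holomorphic
log-volume is defined and EQUALS the mono-analytic one: `C.KummerA D` — "all of which are compatible with the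
respective log-volumes [cf. Proposition 3.9, (ii)]". [claim: Mochizuki2012, status: disputed] -/
theorem kummerA_of_factorwiseRealisations (hV : V.Realizes D)
    (hφ : ∀ (m : ℤ) (j : T.Label) (vQ : T.VQ) (i : V.J j vQ) (R : Set (V.K j vQ i)),
      (V.vol j vQ i).vol (φ m j vQ i '' R) = (V.vol j vQ i).vol R)
    (hfrobAdm : ∀ (m : ℤ) (j : T.Label) (vQ : T.VQ) (A : Set (L.Packet j vQ)),
      C.frobAdm m j vQ A ↔ ∃ R : ∀ i, Set (V.K j vQ i), Pi.map (φ m j vQ) '' (V.e j vQ '' A) = Set.pi univ R ∧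
        ∀ i, (V.vol j vQ i).vol (R i) ≠ 0 ∧ (V.vol j vQ i).vol (R i) ≠ ∞)
    (hfrobLogvol : ∀ (m : ℤ) (j : T.Label) (vQ : T.VQ) (A : Set (L.Packet j vQ)),
      C.frobLogvol m j vQ A =
        ∑ i, V.w j vQ i * (V.vol j vQ i).logvol (Function.eval i '' (Pi.map (φ m j vQ) '' (V.e j vQ '' A)))) :
    C.KummerA D := by
  intro m j vQ A hA
  obtain ⟨R, hR, hR'⟩ := (hV.adm_iff j vQ A).1 hA
  have hne : ∀ i, (R i).Nonempty := fun i => (V.vol j vQ i).nonempty_of_vol_ne_zero (hR' i).1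
  have hne' : ∀ i, (φ m j vQ i '' R i).Nonempty := fun i => (hne i).image _
  have hpi : Pi.map (φ m j vQ) '' (V.e j vQ '' A) = Set.pi univ fun i => φ m j vQ i '' R i := by
    rw [hR]
    exact Set.piMap_image_univ_pi _ R
  refine ⟨(hfrobAdm m j vQ A).2 ⟨_, hpi, fun i => ?_⟩, ?_⟩
  · rw [hφ]
    exact hR' i
  · rw [hfrobLogvol, hpi, hV.logvol_eq]
    unfold FrameVolumePieces.logvol
    rw [hR]
    refine Finset.sum_congr rfl fun i _ => ?_
    rw [Set.eval_image_univ_pi (Set.univ_pi_nonempty_iff.mpr hne'),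
      Set.eval_image_univ_pi (Set.univ_pi_nonempty_iff.mpr hne)]
    unfold FactorVolume.logvol
    rw [hφ]

/-- Hence the final "[precisely!]" clause of Thm. 3.11 (ii) (`LogvolPrecise`, [IUTchIII] p. 156; Prop. 3.9 (iv))
over the all-places container, by abc-iut-c312-1's `logvolPrecise_of_kummerA`. [claim: Mochizuki2012, status: disputed] -/
theorem logvolPrecise_of_factorwiseRealisations (hV : V.Realizes D)
    (hφ : ∀ (m : ℤ) (j : T.Label) (vQ : T.VQ) (i : V.J j vQ) (R : Set (V.K j vQ i)),
      (V.vol j vQ i).vol (φ m j vQ i '' R) = (V.vol j vQ i).vol R)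
    (hfrobAdm : ∀ (m : ℤ) (j : T.Label) (vQ : T.VQ) (A : Set (L.Packet j vQ)),
      C.frobAdm m j vQ A ↔ ∃ R : ∀ i, Set (V.K j vQ i), Pi.map (φ m j vQ) '' (V.e j vQ '' A) = Set.pi univ R ∧
        ∀ i, (V.vol j vQ i).vol (R i) ≠ 0 ∧ (V.vol j vQ i).vol (R i) ≠ ∞)
    (hfrobLogvol : ∀ (m : ℤ) (j : T.Label) (vQ : T.VQ) (A : Set (L.Packet j vQ)),
      C.frobLogvol m j vQ A =
        ∑ i, V.w j vQ i * (V.vol j vQ i).logvol (Function.eval i '' (Pi.map (φ m j vQ) '' (V.e j vQ '' A)))) :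
    C.LogvolPrecise D :=
  C.logvolPrecise_of_kummerA D (V.kummerA_of_factorwiseRealisations C D φ hV hφ hfrobAdm hfrobLogvol)

end FrameVolumePieces

/-! ## 3. `KummerA` over the VERBATIM summandwise container from container-preserving realisations -/

namespace SummandPieces

variable {L : LogShells T} (V : SummandPieces L) (C : Column L) (D : MRData L)
  (Ψ : ℤ → ∀ (j : T.Label) (vQ : T.VQ), (∀ e, V.X j vQ e) → ∀ e, V.X j vQ e)

/-- **[IUTchIII] Thm. 3.11 (ii) (a) (kurims p. 155), real discharge over the VERBATIM container of Rmk. 3.1.1 (iii)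
(abc-iut-c312-5 `SummandPieces`: admissible = "direct product region" over the summands `v⃗`, `μ^log =
Σ_{v⃗} w_{v⃗}·log μ_{v⃗}`) — `KummerA` from container-preserving realisations.** If `D` realises `V` and the column's
`m`-th transported data are `V`'s readings pre-composed with a self-map `Ψ_m` of `Π_{v⃗} M_{v⃗}` carrying direct product
regions to direct product regions of the same weighted log-volume (`PreservesRegions`; e.g. SUMMANDWISE
measure-preserving bijections, abc-iut-c312-5 `PreservesRegions.summandwise` — the shape of a Kummer isomorphism
that is an isometric isomorphism of topological rings on each summand `⊗_α K_{v_α}`), then `C.KummerA D`.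
[claim: Mochizuki2012, status: disputed] -/
theorem kummerA_of_preservesRegions (hV : V.Realizes D)
    (hΨ : ∀ (m : ℤ) (j : T.Label) (vQ : T.VQ), V.PreservesRegions j vQ (Ψ m j vQ))
    (hfrobAdm : ∀ (m : ℤ) (j : T.Label) (vQ : T.VQ) (A : Set (L.Packet j vQ)),
      C.frobAdm m j vQ A ↔ ∃ R : ∀ e, Set (V.X j vQ e), Ψ m j vQ '' (V.e j vQ '' A) = Set.pi univ R ∧
        ∀ e, V.adm j vQ e (R e))
    (hfrobLogvol : ∀ (m : ℤ) (j : T.Label) (vQ : T.VQ) (A : Set (L.Packet j vQ)),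
      C.frobLogvol m j vQ A = ∑ e, V.w j vQ e * V.logμ j vQ e (Function.eval e '' (Ψ m j vQ '' (V.e j vQ '' A)))) :
    C.KummerA D := by
  intro m j vQ A hA
  obtain ⟨R, hR, hadm⟩ := (hV.adm_iff j vQ A).1 hA
  obtain ⟨R', hR', hadm', hvol⟩ := (hΨ m j vQ).map_pi R hadm
  have hpi : Ψ m j vQ '' (V.e j vQ '' A) = Set.pi univ R' := by rw [hR, hR']
  refine ⟨(hfrobAdm m j vQ A).2 ⟨R', hpi, hadm'⟩, ?_⟩
  rw [hfrobLogvol, hpi, hV.logvol_eq, logvol_eq_of_pi hR hadm, ← hvol]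
  refine Finset.sum_congr rfl fun e _ => ?_
  rw [Set.eval_image_univ_pi (Set.univ_pi_nonempty_iff.mpr fun e => V.adm_nonempty j vQ e _ (hadm' e))]

/-- Hence `LogvolPrecise` over the verbatim container (abc-iut-c312-1 `logvolPrecise_of_kummerA`).
[claim: Mochizuki2012, status: disputed] -/
theorem logvolPrecise_of_preservesRegions (hV : V.Realizes D)
    (hΨ : ∀ (m : ℤ) (j : T.Label) (vQ : T.VQ), V.PreservesRegions j vQ (Ψ m j vQ))
    (hfrobAdm : ∀ (m : ℤ) (j : T.Label) (vQ : T.VQ) (A : Set (L.Packet j vQ)),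
      C.frobAdm m j vQ A ↔ ∃ R : ∀ e, Set (V.X j vQ e), Ψ m j vQ '' (V.e j vQ '' A) = Set.pi univ R ∧
        ∀ e, V.adm j vQ e (R e))
    (hfrobLogvol : ∀ (m : ℤ) (j : T.Label) (vQ : T.VQ) (A : Set (L.Packet j vQ)),
      C.frobLogvol m j vQ A = ∑ e, V.w j vQ e * V.logμ j vQ e (Function.eval e '' (Ψ m j vQ '' (V.e j vQ '' A)))) :
    C.LogvolPrecise D :=
  C.logvolPrecise_of_kummerA D (V.kummerA_of_preservesRegions C D Ψ hV hΨ hfrobAdm hfrobLogvol)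

end SummandPieces

/-! ## 4. The frames setting: TEAM A's `StepX.LogvolLogLink` for factorwise-realised columns -/

namespace FrameVolumePieces

section Assembled

variable {S : Situation T} {V : FrameVolumePieces S.L} {n : ℤ}
  {HT : Type} {LogLink : HT → HT → Type} {IsFull : ∀ {s t : HT}, LogLink s t → Prop}
  (lat : LGPGaussianLogThetaLattice LogLink IsFull)
  {Frd : Type} {IsoF : Frd → Frd → Type} {Ob : Frd → Type} {realify : Frd → Frd} {Strip : Type}
  {IsoS : Strip → Strip → Type} {M : ∀ v : T.V, v ∈ T.Vbad → Type} [∀ v h, Monoid (M v h)]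
  (sig : GlobalLGPFrobenioidSignature T.lstar T.V (· ∈ T.Vbad) Frd IsoF Ob realify Strip IsoS M)
  (split : SplittingMonoids M) {ObΔ : Type} {N : ∀ v : T.V, v ∈ T.Vbad → Type} [∀ v h, Monoid (N v h)]
  (qData : QPilotData ObΔ N)
  (thetaBox : ℤ → Ob sig.Clgp → ∀ j vQ, Set (∀ i, V.K j vQ i))
  (qCentre : ObΔ → ∀ j vQ, ∀ i, V.K j vQ i)
  (hq : ∀ j vQ i, qCentre (qPilotObject qData) j vQ i ≠ 0)
  (hadm : ∀ j vQ (H : Set (∀ i, V.K j vQ i)), IsHullSet (V.K j vQ) H → (S.D n).Adm j vQ (V.e j vQ ⁻¹' H))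
  (hfin : ∀ j : T.Label, (Function.support fun vQ => (S.D n).logvol j vQ
    (V.e j vQ ⁻¹' hullSet (V.K j vQ) (qCentre (qPilotObject qData) j vQ))).Finite)
  (C : Column S.L) (φ : ℤ → ∀ (j : T.Label) (vQ : T.VQ) (i : V.J j vQ), V.K j vQ i → V.K j vQ i)

/-- **Step (x)'s log-link compatibility of log-volumes at the frames setting** ([IUTchIII] p. 181; TEAM A
`StepX.LogvolLogLink` := `Column.LogvolPrecise` at the setting's column): for c312-7's per-place assembler
`Setting.ofFrames` over line data realising `V`, every column whose Kummer isomorphisms are realised factorwise by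
volume-preserving maps satisfies `LogvolLogLink` — the `hKumA` input of `stepX_holds` there (`hMono` is gen 2's
`logvolMono_ofFrames`). [claim: Mochizuki2012, status: disputed] -/
theorem logvolLogLink_ofFrames (hV : V.Realizes (S.D n))
    (hφ : ∀ (m : ℤ) (j : T.Label) (vQ : T.VQ) (i : V.J j vQ) (R : Set (V.K j vQ i)),
      (V.vol j vQ i).vol (φ m j vQ i '' R) = (V.vol j vQ i).vol R)
    (hfrobAdm : ∀ (m : ℤ) (j : T.Label) (vQ : T.VQ) (A : Set (S.L.Packet j vQ)),
      C.frobAdm m j vQ A ↔ ∃ R : ∀ i, Set (V.K j vQ i), Pi.map (φ m j vQ) '' (V.e j vQ '' A) = Set.pi univ R ∧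
        ∀ i, (V.vol j vQ i).vol (R i) ≠ 0 ∧ (V.vol j vQ i).vol (R i) ≠ ∞)
    (hfrobLogvol : ∀ (m : ℤ) (j : T.Label) (vQ : T.VQ) (A : Set (S.L.Packet j vQ)),
      C.frobLogvol m j vQ A =
        ∑ i, V.w j vQ i * (V.vol j vQ i).logvol (Function.eval i '' (Pi.map (φ m j vQ) '' (V.e j vQ '' A)))) :
    StepX.LogvolLogLink (Setting.ofFrames n lat sig split qData (V.toRealFrames thetaBox qCentre) hq hadm hfin) C :=
  StepX.logvolLogLink_of_kummerA _ C
    (V.kummerA_of_factorwiseRealisations C (S.D n) φ hV hφ hfrobAdm hfrobLogvol)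

/-- … and `KummerA` itself at the frames setting's column position `(S.D n)` (the `hKumA` binder of TEAM A's
`stepX_holds`, as an implication from the locus as that binder is shaped). [claim: Mochizuki2012, status: disputed] -/
theorem hKumA_ofFrames (hV : V.Realizes (S.D n))
    (hφ : ∀ (m : ℤ) (j : T.Label) (vQ : T.VQ) (i : V.J j vQ) (R : Set (V.K j vQ i)),
      (V.vol j vQ i).vol (φ m j vQ i '' R) = (V.vol j vQ i).vol R)
    (hfrobAdm : ∀ (m : ℤ) (j : T.Label) (vQ : T.VQ) (A : Set (S.L.Packet j vQ)),
      C.frobAdm m j vQ A ↔ ∃ R : ∀ i, Set (V.K j vQ i), Pi.map (φ m j vQ) '' (V.e j vQ '' A) = Set.pi univ R ∧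
        ∀ i, (V.vol j vQ i).vol (R i) ≠ 0 ∧ (V.vol j vQ i).vol (R i) ≠ ∞)
    (hfrobLogvol : ∀ (m : ℤ) (j : T.Label) (vQ : T.VQ) (A : Set (S.L.Packet j vQ)),
      C.frobLogvol m j vQ A =
        ∑ i, V.w j vQ i * (V.vol j vQ i).logvol (Function.eval i '' (Pi.map (φ m j vQ) '' (V.e j vQ '' A))))
    {Loc : Cor312Proof.Locus → Prop} :
    Loc .thm3_11_ii_a →
      C.KummerA (S.D (Setting.ofFrames n lat sig split qData (V.toRealFrames thetaBox qCentre) hq hadm hfin).n) :=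
  fun _ => V.kummerA_of_factorwiseRealisations C (S.D n) φ hV hφ hfrobAdm hfrobLogvol

end Assembled

end FrameVolumePieces

/-! ## 5. Vacuity audit extended: (ii) ⟺ (Ind3) under every honest volume twist -/

section VacuityAudit

variable {L : LogShells T} (M : Type) [Field M] (D : MRData L)
  (unitImage : ℤ → ℕ → ∀ (j : T.Label) (vQ : T.VQ), Set (L.Packet j vQ))
  (ballImage : ℤ → ∀ (j : T.Label) (vQ : T.VQ), Set (L.Packet j vQ)) (thetaDiv : ℤ → LgpDivisor M T.lstar)

/-- **VACUITY AUDIT (neutral), factorwise twists.** For line data `D` realising the all-places container `V` and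
abc-iut-c312-5's column `Column.ofDivisors` whose (a)-data at `m` are `V`'s readings through the factorwise
realisation `Π_i φ_{m,i}` — ANY volume-preserving `φ_{m,i}`, e.g. isometric field automorphisms, `−1`, unit
multiplications (§1, §6) — and whose (b)(c)-data are the coric ones, abc-iut-c312-1's typed [IUTchIII] Thm. 3.11
(ii) is STILL equivalent to (Ind3) alone (c312-5's `partII_iff_ind3_of_coric` is the case `φ := id`).
[claim: Mochizuki2012, status: disputed] -/
theorem FrameVolumePieces.partII_iff_ind3_of_factorwiseTwist (V : FrameVolumePieces L) (hV : V.Realizes D)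
    (φ : ℤ → ∀ (j : T.Label) (vQ : T.VQ) (i : V.J j vQ), V.K j vQ i → V.K j vQ i)
    (hφ : ∀ (m : ℤ) (j : T.Label) (vQ : T.VQ) (i : V.J j vQ) (R : Set (V.K j vQ i)),
      (V.vol j vQ i).vol (φ m j vQ i '' R) = (V.vol j vQ i).vol R) :
    (Column.ofDivisors L M
        (fun m j vQ A => ∃ R : ∀ i, Set (V.K j vQ i), Pi.map (φ m j vQ) '' (V.e j vQ '' A) = Set.pi univ R ∧
          ∀ i, (V.vol j vQ i).vol (R i) ≠ 0 ∧ (V.vol j vQ i).vol (R i) ≠ ∞)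
        (fun m j vQ A =>
          ∑ i, V.w j vQ i * (V.vol j vQ i).logvol (Function.eval i '' (Pi.map (φ m j vQ) '' (V.e j vQ '' A))))
        (fun _ => D.Ψ) (fun _ => D.Mmod) unitImage ballImage thetaDiv).PartII D ↔
      (Column.ofDivisors L M
        (fun m j vQ A => ∃ R : ∀ i, Set (V.K j vQ i), Pi.map (φ m j vQ) '' (V.e j vQ '' A) = Set.pi univ R ∧
          ∀ i, (V.vol j vQ i).vol (R i) ≠ 0 ∧ (V.vol j vQ i).vol (R i) ≠ ∞)
        (fun m j vQ A =>
          ∑ i, V.w j vQ i * (V.vol j vQ i).logvol (Function.eval i '' (Pi.map (φ m j vQ) '' (V.e j vQ '' A))))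
        (fun _ => D.Ψ) (fun _ => D.Mmod) unitImage ballImage thetaDiv).Ind3 D := by
  rw [Column.partII_iff]
  constructor
  · rintro ⟨-, -, -, h⟩
    exact h
  · intro h
    exact ⟨V.kummerA_of_factorwiseRealisations _ D φ hV hφ (fun _ _ _ _ => Iff.rfl) (fun _ _ _ _ => rfl),
      fun _ _ _ => rfl, fun _ _ => rfl, h⟩

/-- **VACUITY AUDIT (neutral), container-preserving twists over the VERBATIM container.** The same for
abc-iut-c312-5's `SummandPieces`: with (a)-data read through ANY realisations in `PreservesRegions` (summandwise
measure-preserving bijections, …) and coric (b)(c)-data, the typed Thm. 3.11 (ii) is equivalent to (Ind3) alone.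
[claim: Mochizuki2012, status: disputed] -/
theorem SummandPieces.partII_iff_ind3_of_preservesRegionsTwist (V : SummandPieces L) (hV : V.Realizes D)
    (Ψ : ℤ → ∀ (j : T.Label) (vQ : T.VQ), (∀ e, V.X j vQ e) → ∀ e, V.X j vQ e)
    (hΨ : ∀ (m : ℤ) (j : T.Label) (vQ : T.VQ), V.PreservesRegions j vQ (Ψ m j vQ)) :
    (Column.ofDivisors L M
        (fun m j vQ A => ∃ R : ∀ e, Set (V.X j vQ e), Ψ m j vQ '' (V.e j vQ '' A) = Set.pi univ R ∧
          ∀ e, V.adm j vQ e (R e))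
        (fun m j vQ A => ∑ e, V.w j vQ e * V.logμ j vQ e (Function.eval e '' (Ψ m j vQ '' (V.e j vQ '' A))))
        (fun _ => D.Ψ) (fun _ => D.Mmod) unitImage ballImage thetaDiv).PartII D ↔
      (Column.ofDivisors L M
        (fun m j vQ A => ∃ R : ∀ e, Set (V.X j vQ e), Ψ m j vQ '' (V.e j vQ '' A) = Set.pi univ R ∧
          ∀ e, V.adm j vQ e (R e))
        (fun m j vQ A => ∑ e, V.w j vQ e * V.logμ j vQ e (Function.eval e '' (Ψ m j vQ '' (V.e j vQ '' A))))
        (fun _ => D.Ψ) (fun _ => D.Mmod) unitImage ballImage thetaDiv).Ind3 D := by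
  rw [Column.partII_iff]
  constructor
  · rintro ⟨-, -, -, h⟩
    exact h
  · intro h
    exact ⟨V.kummerA_of_preservesRegions _ D Ψ hV hΨ (fun _ _ _ _ => Iff.rfl) (fun _ _ _ _ => rfl),
      fun _ _ _ => rfl, fun _ _ => rfl, h⟩

end VacuityAudit

/-! ## 6. Non-vacuity: non-identity realisations preserving the factor volumes -/

/-- Complex conjugation preserves the radial factor volume (a non-identity realisation at a complex place).
[cite: MochizukiAbsTopIII2015, Prop. 5.7 (ii)(a) p. 138] -/
example (R : Set ℂ) : FactorVolume.complexRadial.vol (starRingEnd ℂ '' R) = FactorVolume.complexRadial.vol R :=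
  FactorVolume.complexRadial_vol_image_of_norm_map_eq _ Complex.norm_conj R

/-- A unit rotation `z ↦ u·z`, `‖u‖ = 1`, preserves the radial factor volume. [cite: MochizukiAbsTopIII2015, Prop. 5.7 (ii)(a) p. 138] -/
example (u : ℂ) (hu : ‖u‖ = 1) (R : Set ℂ) :
    FactorVolume.complexRadial.vol ((u * ·) '' R) = FactorVolume.complexRadial.vol R :=
  FactorVolume.complexRadial_vol_image_of_norm_map_eq _ (fun z => by rw [norm_mul, hu, one_mul]) R

/-- `z ↦ −z` preserves the radial factor volume. [cite: MochizukiAbsTopIII2015, Prop. 5.7 (ii)(a) p. 138] -/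
example (R : Set ℂ) : FactorVolume.complexRadial.vol ((- ·) '' R) = FactorVolume.complexRadial.vol R :=
  FactorVolume.complexRadial_vol_image_of_norm_map_eq _ norm_neg R

/-- On an ultrametric factor, `x ↦ −x` as an additive homeomorphism preserves the Haar factor volume (a
non-identity norm-preserving realisation; §1). [cite: MochizukiAbsTopIII2015, Prop. 5.7 (i)(b) p. 138] -/
example (K : Type) [NontriviallyNormedField K] [IsUltrametricDist K] [ProperSpace K] [MeasurableSpace K]
    [BorelSpace K] (R : Set K) :
    (FactorVolume.ofUltrametric K).vol
        (({ AddEquiv.neg K with continuous_toFun := continuous_neg, continuous_invFun := continuous_neg } :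
          K ≃ₜ+ K) '' R) = (FactorVolume.ofUltrametric K).vol R :=
  FactorVolume.ofUltrametric_vol_image_of_norm_map_eq K _ (fun x => norm_neg x) R

/-- On an ultrametric factor, multiplication by a unit `x ∈ 𝒪_K^×` preserves the Haar factor volume (abc-iut-S2
`localVolume_units_smul_of_norm_eq_one`; the shape of a Kummer twist by a unit). [cite: MochizukiAbsTopIII2015, Prop. 5.7 (i)(b) p. 138] -/
example (K : Type) [NontriviallyNormedField K] [IsUltrametricDist K] [ProperSpace K] [MeasurableSpace K]
    [BorelSpace K] (x : Kˣ) (hx : ‖(x : K)‖ = 1) (R : Set K) :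
    (FactorVolume.ofUltrametric K).vol (x • R) = (FactorVolume.ofUltrametric K).vol R :=
  localVolume_units_smul_of_norm_eq_one K x hx R

/-- The identity realisation preserves every factor volume (the strictified reading is the special case). [folklore] -/
example {K : Type} [NormedField K] (μ : FactorVolume K) (R : Set K) : μ.vol (id '' R) = μ.vol R := by rw [Set.image_id]

end Cor312Vol

end IUTFork

end Summit.ABC

end
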